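import Literature.Geometry.Kaehler.RiemannSurfaceGaloisCovering
import Literature.Geometry.Kaehler.RiemannSurfaceChevalleyWeilMultiplicities
import HarnessLib

/-!
# Chevalley–Weil for the finite quotients of `π₁`: every finite quotient `G` of the fundamental group of a compact Riemann surface of genus `g ≥ 2` acts on the holomorphic differentials of the corresponding cover with character `1 + (g − 1)ρ_G`

Layer `Literature/Geometry/Kaehler`, sequel WITHOUT definitions of `RiemannSurfaceGaloisCovering`
(`exists_free_holomorphicSMul_of_surjective`: a finite quotient `φ : π₁(M, x₀) ↠ G` acts freely by biholomorphisms on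
the compact Riemann surface `T = M̃ ⧸ ker φ`, the quotient map `T → M` being a holomorphic `|G|`-sheeted covering,
`g(T) − 1 = |G|(g − 1)`), of `RiemannSurfaceAutomorphismGroup` (`autGroup`, `autOfBijective`, `finite_autGroup`)
and of `RiemannSurfaceChevalleyWeilMultiplicities` (Breuer Example 12.5 ∕ Chevalley–Weil 1934 for a fixed point
free `G ≤ Aut T`: `tr(h | 𝓗¹(T)) = 1 + (g(T/G) − 1)·ρ_G(h)` and `g(T) = 1 + |G|(g(T/G) − 1)`).

T. Breuer, *Characters and Automorphism Groups of Compact Riemann Surfaces* (2000), Example 12.5 (free actions: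
`χ = 1_G + (g(X/G) − 1)·ρ_G`, «shown already in [CW34, p. 361]»); C. Chevalley, A. Weil, *Über das Verhalten der
Integrale 1. Gattung bei Automorphismen des Funktionenkörpers*, Abh. Math. Sem. Hamburg 10 (1934).  A. Hatcher,
*Algebraic Topology* (2002), §1.3 Exercise 17 (the normal covering with group `G/N`).

## What is proved (everything; no definitions, no instances, no named facts)

* `exists_monoidHom_autGroup_of_holomorphicSMul` — a free holomorphic action of a group `G` on a compact connected
  Riemann surface `T` is an injective homomorphism `ι : G → Aut T` with `ι g = (g • ·)`;
* **`exists_free_autGroup_trace_oneFormRep_of_surjective`** — for `M` compact of genus `g ≥ 2` and a finite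
  quotient `φ : π₁(M, x₀) ↠ G`: a compact connected Riemann surface `T` of genus `|G|(g − 1) + 1 ≥ 2`, an injective
  `ι : G → Aut T` whose image acts fixed point freely, the orbit surface `T ⧸ ι(G)` of genus `g`, and
  **`tr(ι g | 𝓗¹(T)) = 1 + (g − 1)·ρ_G(g)`** for every `g ∈ G` (`ρ_G` the regular character) — every finite
  quotient of the surface group `π₁(M_g)` is realised on holomorphic differentials with character
  `1_G + (g − 1)ρ_G` (Chevalley–Weil).

## References

* T. Breuer, *Characters and Automorphism Groups of Compact Riemann Surfaces*, LMS Lecture Note Series 280,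
  Cambridge University Press (2000), Example 12.5, Theorem 12.1. [Breuer2000]
* C. Chevalley, A. Weil, Abh. Math. Sem. Univ. Hamburg 10 (1934) 358–361. [ChevalleyWeil1934Integrale]
* A. Hatcher, *Algebraic Topology*, Cambridge University Press (2002), §1.3 Exercise 17, Prop. 1.39–1.40.
  [HatcherAT2002]
-/

noncomputable section

open Set Function TopologicalSpace MulAction
open _root_.Topology
open scoped Manifold ContDiff

namespace Literature.Geometry.Kaehler

open Literature.Topology.CoveringSpaces

namespace RiemannSurface

universe u

/-! ### §1 A free holomorphic action as a subgroup of `Aut T` -/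

/-- **A free holomorphic action of `G` on a connected Riemann surface `T` is an embedding `ι : G ↪ Aut T`** with
`ι g` the translation `t ↦ g • t` (each translation is a bijective holomorphic self-map, I.1.5).
[cite: FarkasKra1992, III.7.7, I.1.5] [cite: Breuer2000, Example 12.5] -/
theorem exists_monoidHom_autGroup_of_holomorphicSMul {T : Type*} [TopologicalSpace T] [ChartedSpace ℂ T]
    [IsManifold 𝓘(ℂ, ℂ) ω T] [PreconnectedSpace T] [T2Space T] {G : Type*} [Group G] [MulAction G T]
    [HolomorphicSMul G T] (hfree : ∀ t : T, stabilizer G t = ⊥) [Nonempty T] :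
    ∃ ι : G →* autGroup T, Injective ι ∧ ∀ (g : G) (t : T), ((ι g : autGroup T) : Equiv.Perm T) t = g • t := by
  let ι₀ : G → autGroup T := fun g ↦
    autOfBijective (fun t : T ↦ g • t) (HolomorphicSMul.mdifferentiable_const_smul g) (MulAction.bijective g)
  have hι₀ : ∀ (g : G) (t : T), ((ι₀ g : autGroup T) : Equiv.Perm T) t = g • t := fun g t ↦ rfl
  let ι : G →* autGroup T :=
    { toFun := ι₀
      map_one' := by
        apply Subtype.ext; apply Equiv.ext; intro t
        rw [hι₀, one_smul]; rfl
      map_mul' := fun g h ↦ by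
        apply Subtype.ext; apply Equiv.ext; intro t
        rw [hι₀, mul_smul]; rfl }
  refine ⟨ι, fun g h hgh ↦ ?_, hι₀⟩
  obtain ⟨t⟩ := ‹Nonempty T›
  have ht : g • t = h • t := by
    rw [← hι₀ g t, ← hι₀ h t]
    exact congrArg (fun σ : autGroup T ↦ (σ : Equiv.Perm T) t) hgh
  have hmem : h⁻¹ * g ∈ stabilizer G t := by
    rw [MulAction.mem_stabilizer_iff, mul_smul, ht, inv_smul_smul]
  rw [hfree t, Subgroup.mem_bot, inv_mul_eq_one] at hmem
  exact hmem.symm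

/-! ### §2 Chevalley–Weil for the finite quotients of `π₁(M, x₀)` -/

variable {M : Type u} [TopologicalSpace M] [ChartedSpace ℂ M] [ConnectedSpace M] [IsManifold 𝓘(ℂ, ℂ) ω M]
  [CompactSpace M] [T2Space M]

/-- **Every finite quotient of the surface group `π₁(M)` (`g(M) = g ≥ 2`) is realised on holomorphic differentials
with the Chevalley–Weil character `1_G + (g − 1)ρ_G`.**  For a surjection `φ : π₁(M, x₀) ↠ G` onto a finite group
there are a compact connected Riemann surface `T` (the Galois cover `M̃ ⧸ ker φ`) of genus `|G|(g − 1) + 1 ≥ 2` and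
an injective `ι : G → Aut T` whose image `ι(G)` acts fixed point freely with orbit surface `T ⧸ ι(G)` of genus
`g`, such that for every `h ∈ G` the trace of `(ι h)⁻¹^*` on `𝓗¹(T)` is `1 + (g − 1)·ρ_G(h)`, `ρ_G(1) = |G|`,
`ρ_G(h) = 0` for `h ≠ 1`. [cite: Breuer2000, Example 12.5] [cite: ChevalleyWeil1934Integrale]
[cite: HatcherAT2002, §1.3 Exercise 17 (p. 82)] -/
theorem exists_free_autGroup_trace_oneFormRep_of_surjective (h2 : 2 ≤ arithGenus M) (x₀ : M)
    {G : Type*} [Group G] [Finite G] [DecidableEq G] (φ : FundamentalGroup M x₀ →* G) (hφ : Surjective φ) :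
    ∃ (T : Type u) (_ : TopologicalSpace T) (_ : ChartedSpace ℂ T) (_ : IsManifold 𝓘(ℂ, ℂ) ω T)
      (_ : CompactSpace T) (_ : T2Space T) (_ : ConnectedSpace T) (_ : Finite (autGroup T)) (ι : G →* autGroup T),
      Injective ι ∧ (∀ (h : ↥ι.range) (P : T), h • P = P → h = 1) ∧
        (arithGenus T : ℤ) - 1 = Nat.card G * ((arithGenus M : ℤ) - 1) ∧ 2 ≤ arithGenus T ∧
        arithGenus (OrbitSurface ↥ι.range T) = arithGenus M ∧
        ∀ h : G, LinearMap.trace ℂ ↥(holomorphicOneForms T) (oneFormRep T (ι h)) =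
          1 + ((arithGenus M : ℂ) - 1) * (if h = 1 then (Nat.card G : ℂ) else 0) := by
  classical
  obtain ⟨T, i1, i2, i3, i4, i5, i6, i7, q, hhol, hfree, -, -, -, -, -, -, hg⟩ :=
    exists_free_holomorphicSMul_of_surjective x₀ φ hφ
  haveI := hhol
  -- genus of `T`: `g(T) − 1 = |G|(g − 1) ≥ g − 1 ≥ 1`
  haveI : Nonempty G := ⟨1⟩
  have hcard : 1 ≤ Nat.card G := Nat.one_le_iff_ne_zero.2 Nat.card_pos.ne'
  have hT2 : 2 ≤ arithGenus T := by
    have h1 : (1 : ℤ) ≤ Nat.card G := by exact_mod_cast hcard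
    have h2' : (2 : ℤ) ≤ arithGenus M := by exact_mod_cast h2
    have : (2 : ℤ) ≤ arithGenus T := by nlinarith
    exact_mod_cast this
  haveI hfin : Finite (autGroup T) := finite_autGroup hT2
  obtain ⟨ι, hinj, hι⟩ := exists_monoidHom_autGroup_of_holomorphicSMul (T := T) (G := G) hfree
  -- the image acts freely
  have hfree' : ∀ (h : ↥ι.range) (P : T), h • P = P → h = 1 := by
    rintro ⟨_, g, rfl⟩ P hP
    have hP' : g • P = P := by rw [← hι g P]; exact hP
    have hg1 : g ∈ stabilizer G P := hP'
    rw [hfree P, Subgroup.mem_bot] at hg1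
    subst hg1
    exact Subtype.ext (map_one ι)
  -- `|ι(G)| = |G|` and the genus of the orbit surface
  have hcardr : Nat.card ↥ι.range = Nat.card G := Nat.card_congr (MonoidHom.ofInjective hinj).toEquiv.symm
  have hgen := arithGenus_eq_one_add_card_mul_of_free ι.range hfree'
  rw [hcardr] at hgen
  have hγ : arithGenus (OrbitSurface ↥ι.range T) = arithGenus M := by
    have h0 : (Nat.card G : ℤ) ≠ 0 := by exact_mod_cast Nat.card_pos.ne'
    have : (Nat.card G : ℤ) * ((arithGenus (OrbitSurface ↥ι.range T) : ℤ) - 1) =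
        Nat.card G * ((arithGenus M : ℤ) - 1) := by linarith
    exact_mod_cast sub_left_injective (mul_left_cancel₀ h0 this)
  refine ⟨T, i1, i2, i3, i4, i5, i6, hfin, ι, hinj, hfree', hg, hT2, hγ, fun h ↦ ?_⟩
  have htr := trace_oneFormRep_eq_of_free ι.range hfree' ⟨ι h, h, rfl⟩
  rw [hγ, hcardr] at htr
  have hiff : ((⟨ι h, h, rfl⟩ : ↥ι.range) = 1) ↔ h = 1 := by
    rw [← Subtype.coe_inj]
    change ι h = ((1 : ↥ι.range) : autGroup T) ↔ h = 1
    rw [OneMemClass.coe_one, ← map_one ι]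
    exact hinj.eq_iff
  simp only [hiff] at htr
  exact htr

end RiemannSurface

end Literature.Geometry.Kaehler

end
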